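import Mathlib
import Literature.Analysis.ValidatedNumerics.ConeDirichletInverseInterior
import HarnessLib

/-!
# Termwise Laplacian of a cone series and the interior equation of the certificate's zero

Topic `Literature/Analysis/ValidatedNumerics`.  For `ϱ > 1` every element `u = Σ u_{ab} ζ^aζ̄^b` of the
cone Wiener algebra `W = ℓ¹_ϱ(ζ^aζ̄^b)` (`WeightedWienerAlgebra.lean`) represents a function
`eval u` (`ConeAlgebraEvaluation.lean`) whose directional Laplacian on the OPEN unit disk may be computed
termwise:

* `lapRI_eval` — **`Δ(eval u)(z) = Σ_{(a,b)} u_{ab} · 4ab z^{a−1} z̄^{b−1}`** for `|z| < 1`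
  (`Δ = ConeMonomial.lapRI`; termwise `Δ(ζ^aζ̄^b) = 4ab ζ^{a−1}ζ̄^{b−1}`, `ConeMonomial.lapRI_monomial`;
  the differentiated series converge because `(a+b)², (a+b) ≤ C ϱ^{a+b}`, `ϱ > 1`: `deg_sq_le_weight`);
* `lapRI_eval_eq_zero_of_purePowers` — if `u` is supported on pure powers `ζ^a`, `ζ̄^b` (a HARMONIC
  datum, e.g. the harmonic extension `H[g̃]` of boundary data) then `Δ(eval u) = 0` on the open disk;
* `lapRI_eval_of_semilinMap_eq_zero` — **the interior equation of the certificate's zero:** if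
  `x − Δ_D⁻¹(v x + Σ_{k≤m} c_k x^k) − g = 0` in `W` (the zero of
  `ConeSemilinear.cone_existsUnique_zero_of_semilin`) with `g` harmonic (pure powers), then on `|z| < 1`
  `Δ(eval x)(z) = v(z)·x(z) + Σ_{k≤m} c_k(z)·x(z)^k` — together with `ConeEval.eval_eq_of_semilinMap_eq_zero`
  (`x = g` on `|ζ| = 1`, `ConeDirichletInverseSemantics.lean`) this is the classical Dirichlet problem in
  the `ζ`-chart solved by the represented function of the certificate's (infinite) zero.

## Sources

[ArioliKoch2019] §2 eqs. (2.7)–(2.10) and Lemma 2.1 (`Δ = 4∂_z∂_z̄` termwise on the disk algebra; the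
termwise Dirichlet inverse), §3 Lemma 3.1 ("If `ρ > 1` then the functions in `A_ρ` extend analytically"
— termwise differentiation is legitimate), eq. (1.4) (p. 4) and §4 Lemma 4.1 (pp. 9–10) (fixed points of
`G(u) = (−Δ)⁻¹(w f′(u))` solve `−Δu = w f′(u)`).  Monomial version.

## What is NOT covered

Fréchet-`C²` regularity of `eval u` / equality of `lapRI` with Mathlib's `Δ` (needed to compose with the
conformal pull-back `ConformalLaplacian.laplacian_comp_eq_of_analyticAt`, p550475, and the Liouville step
p532316 into the Grad–Shafranov statement on `Ω_W`); non-harmonic data `g`; float model.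

## Provenance

AI-produced formalisation (cell certnum, seat certnum-ode-2, 2026-08-27).
-/

set_option autoImplicit false

open scoped BigOperators Topology
open Complex Filter Set

noncomputable section

namespace Literature.Analysis.ValidatedNumerics

namespace ConeEval

open WeightedSeq WienerAlgebra ConeMonomial ConeSemilinear

variable {ϱ : ℝ}

/-! ### §0. Continuity on the closed disk -/

/-- **`eval u` is continuous on the closed unit disk** (uniformly convergent series, terms bounded by
`|u_m|`; `ϱ ≥ 1`): the represented function of a certificate's zero is continuous up to the boundary.
[cite: ArioliKoch2019, §3 (3.1)–(3.2) (A_ρ functions are continuous on Ω̄)] -/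
theorem continuousOn_eval (hϱ : 1 ≤ ϱ) (u : Wiener (coneSubmultWeight hϱ)) :
    ContinuousOn (eval hϱ u) (Metric.closedBall 0 1) := by
  unfold eval
  refine continuousOn_tsum (fun m => ?_) (summable_abs_cf hϱ u) fun m ζ hζ => ?_
  · have hc : Continuous (mono m) := by
      unfold mono monomial
      exact (continuous_id.pow _).mul (Complex.continuous_conj.pow _)
    exact (continuous_const.mul hc).continuousOn
  · rw [Metric.mem_closedBall, dist_zero_right] at hζ
    rw [norm_mul, Complex.norm_real, Real.norm_eq_abs]
    have hm : ‖mono m ζ‖ ≤ 1 := by rw [norm_mono]; exact pow_le_one₀ (norm_nonneg _) hζ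
    calc |cf u m| * ‖mono m ζ‖ ≤ |cf u m| * 1 := mul_le_mul_of_nonneg_left hm (abs_nonneg _)
      _ = |cf u m| := mul_one _

/-! ### §1. Quadratic growth against the weight -/

/-- Binomial lower bound: `(n(n−1)/2) x² ≤ (1 + x)^n` for `x ≥ 0`.
[cite: ArioliKoch2019, §3 Lemma 3.1 (ρ > 1 regularity; elementary growth estimate)] -/
theorem choose_two_mul_sq_le_pow {x : ℝ} (hx : 0 ≤ x) (n : ℕ) :
    (n : ℝ) * ((n : ℝ) - 1) / 2 * x ^ 2 ≤ (1 + x) ^ n := by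
  induction n with
  | zero => simp
  | succ n ih =>
    have hB : 1 + (n : ℝ) * x ≤ (1 + x) ^ n := one_add_mul_le_pow (by linarith) n
    have hpow : 0 ≤ (1 + x) ^ n := pow_nonneg (by linarith) n
    push_cast
    calc ((n : ℝ) + 1) * ((n : ℝ) + 1 - 1) / 2 * x ^ 2
        = (n : ℝ) * ((n : ℝ) - 1) / 2 * x ^ 2 + x * ((n : ℝ) * x) := by ring
      _ ≤ (1 + x) ^ n + x * ((1 + x) ^ n - 1) := by
          have : x * ((n : ℝ) * x) ≤ x * ((1 + x) ^ n - 1) := mul_le_mul_of_nonneg_left (by linarith) hx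
          linarith
      _ ≤ (1 + x) ^ (n + 1) := by rw [pow_succ]; nlinarith

/-- `n² ≤ (2/(ϱ−1)² + 1/(ϱ−1)) ϱ^n` for `ϱ > 1`: quadratic growth is dominated by the weight.
[cite: ArioliKoch2019, §3 Lemma 3.1 (ρ > 1)] -/
theorem deg_sq_le_weight (hϱ : 1 < ϱ) (n : ℕ) :
    (n : ℝ) ^ 2 ≤ (2 / (ϱ - 1) ^ 2 + 1 / (ϱ - 1)) * ϱ ^ n := by
  have hx : 0 < ϱ - 1 := sub_pos.2 hϱ
  have h1 := choose_two_mul_sq_le_pow hx.le n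
  have h2 : 1 + (n : ℝ) * (ϱ - 1) ≤ (1 + (ϱ - 1)) ^ n := one_add_mul_le_pow (by linarith) n
  rw [add_sub_cancel] at h1 h2
  have hp : 1 ≤ ϱ ^ n := one_le_pow₀ hϱ.le
  have hA : (n : ℝ) * ((n : ℝ) - 1) ≤ 2 / (ϱ - 1) ^ 2 * ϱ ^ n := by
    rw [div_mul_eq_mul_div, le_div_iff₀ (by positivity)]
    nlinarith
  have hB : (n : ℝ) ≤ 1 / (ϱ - 1) * ϱ ^ n := by
    rw [div_mul_eq_mul_div, one_mul, le_div_iff₀ hx]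
    nlinarith
  calc (n : ℝ) ^ 2 = (n : ℝ) * ((n : ℝ) - 1) + n := by ring
    _ ≤ 2 / (ϱ - 1) ^ 2 * ϱ ^ n + 1 / (ϱ - 1) * ϱ ^ n := add_le_add hA hB
    _ = (2 / (ϱ - 1) ^ 2 + 1 / (ϱ - 1)) * ϱ ^ n := by ring

/-! ### §2. The series of `u` along a line and its termwise derivatives -/

/-- [folklore] -/
private theorem iteratedDeriv_two' (f : ℝ → ℂ) : iteratedDeriv 2 f = deriv (deriv f) := by
  rw [iteratedDeriv_eq_iterate]
  rfl

/-- [folklore] -/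
private theorem norm_line_le_one' {z c : ℂ} (hc : ‖c‖ ≤ 1) {t : ℝ} (ht : t ∈ Ioo (-(1 - ‖z‖)) (1 - ‖z‖)) :
    ‖z + (t : ℂ) * c‖ ≤ 1 := by
  have habs : |t| < 1 - ‖z‖ := abs_lt.2 ⟨ht.1, ht.2⟩
  calc ‖z + (t : ℂ) * c‖ ≤ ‖z‖ + ‖(t : ℂ) * c‖ := norm_add_le _ _
    _ ≤ ‖z‖ + |t| * 1 := by
        rw [norm_mul, Complex.norm_real, Real.norm_eq_abs]
        exact add_le_add le_rfl (mul_le_mul_of_nonneg_left hc (abs_nonneg _))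
    _ ≤ 1 := by linarith

/-- `u` along the line `z + tc`: `Σ_m u_m M_m(z + tc)` (equal to `eval u (z + tc)` term by term).
[cite: ArioliKoch2019, §3 eq. (3.1)] -/
def lineSeries (hϱ : 1 ≤ ϱ) (u : Wiener (coneSubmultWeight hϱ)) (z c : ℂ) (t : ℝ) : ℂ :=
  ∑' m, (cf u m : ℂ) * mpath (m 0) (m 1) z c t

/-- Its termwise first derivative. [cite: ArioliKoch2019, §2 eq. (2.7)] -/
def lineSeriesD1 (hϱ : 1 ≤ ϱ) (u : Wiener (coneSubmultWeight hϱ)) (z c : ℂ) (t : ℝ) : ℂ :=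
  ∑' m, (cf u m : ℂ) * mpathD1 (m 0) (m 1) z c t

/-- Its termwise second derivative. [cite: ArioliKoch2019, §2 eq. (2.7)] -/
def lineSeriesD2 (hϱ : 1 ≤ ϱ) (u : Wiener (coneSubmultWeight hϱ)) (z c : ℂ) (t : ℝ) : ℂ :=
  ∑' m, (cf u m : ℂ) * mpathD2 (m 0) (m 1) z c t

/-- `eval u (z + tc) = lineSeries u z c t` (identically in `t`: the same series).
[cite: ArioliKoch2019, §3 eq. (3.1)] -/
theorem eval_line_eq (hϱ : 1 ≤ ϱ) (u : Wiener (coneSubmultWeight hϱ)) (z c : ℂ) :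
    (fun t : ℝ => eval hϱ u (z + (t : ℂ) * c)) = lineSeries hϱ u z c := by
  funext t
  unfold eval lineSeries
  exact tsum_congr fun m => by rw [mpath_eq]; rfl

/-- The degree of an exponent against the weight: `a + b ≤ C₁ ϱ^{a+b}` and `(a+b)² ≤ C₂ ϱ^{a+b}` (`ϱ > 1`).
[cite: ArioliKoch2019, §3 Lemma 3.1 (ρ > 1)] -/
theorem deg_le_weight (hϱ : 1 < ϱ) (m : Fin 2 →₀ ℕ) :
    ((m 0 : ℕ) : ℝ) + (m 1 : ℕ) ≤ (1 / (ϱ - 1) + 2) * (coneSubmultWeight hϱ.le).toFun m ∧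
      (((m 0 : ℕ) : ℝ) + (m 1 : ℕ)) ^ 2 ≤ (2 / (ϱ - 1) ^ 2 + 1 / (ϱ - 1)) * (coneSubmultWeight hϱ.le).toFun m := by
  rw [coneSubmultWeight_apply]
  have h1 := deg_add_two_le_weight hϱ (m 0 + m 1)
  have h2 := deg_sq_le_weight hϱ (m 0 + m 1)
  push_cast at h1 h2
  exact ⟨by linarith, h2⟩

/-- **First termwise derivative of `u` along a line** (`|t| < 1 − |z|`, `|c| ≤ 1`, `ϱ > 1`; bound
`(a+b)|u_m| ≤ C₁ ϱ^{a+b}|u_m|`). [cite: ArioliKoch2019, §3 Lemma 3.1 (ρ > 1 regularity)] -/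
theorem hasDerivAt_lineSeries (hϱ1 : 1 < ϱ) (u : Wiener (coneSubmultWeight hϱ1.le)) {z c : ℂ}
    (hz : ‖z‖ < 1) (hc : ‖c‖ ≤ 1) {t : ℝ} (ht : t ∈ Ioo (-(1 - ‖z‖)) (1 - ‖z‖)) :
    HasDerivAt (lineSeries hϱ1.le u z c) (lineSeriesD1 hϱ1.le u z c t) t := by
  have hϱ : 1 ≤ ϱ := hϱ1.le
  have h0 : (0 : ℝ) ∈ Ioo (-(1 - ‖z‖)) (1 - ‖z‖) := by constructor <;> linarith
  set C : ℝ := 1 / (ϱ - 1) + 2 with hC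
  have hdom : Summable fun m => C * (|cf u m| * (coneSubmultWeight hϱ).toFun m) := (mem_cf u).mul_left C
  unfold lineSeries lineSeriesD1
  refine hasDerivAt_tsum_of_isPreconnected hdom isOpen_Ioo isPreconnected_Ioo
    (fun m y _ => (hasDerivAt_mpath (m 0) (m 1) z c y).const_mul _) (fun m y hy => ?_) h0 ?_ ht
  · rw [norm_mul, Complex.norm_real, Real.norm_eq_abs]
    have hb := norm_mpathD1_le (m 0) (m 1) (norm_line_le_one' hc hy) hc
    have hg := (deg_le_weight hϱ1 m).1
    calc |cf u m| * ‖mpathD1 (m 0) (m 1) z c y‖ ≤ |cf u m| * (C * (coneSubmultWeight hϱ).toFun m) :=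
          mul_le_mul_of_nonneg_left (hb.trans hg) (abs_nonneg _)
      _ = C * (|cf u m| * (coneSubmultWeight hϱ).toFun m) := by ring
  · refine Summable.of_norm_bounded ((summable_abs_cf hϱ u).mul_right 1) fun m => ?_
    rw [norm_mul, Complex.norm_real, Real.norm_eq_abs, mpath_eq, monomial, norm_mul, norm_pow, norm_pow,
      Complex.norm_conj]
    have hw : ‖z + ((0 : ℝ) : ℂ) * c‖ ≤ 1 := norm_line_le_one' hc h0
    refine mul_le_mul_of_nonneg_left ?_ (abs_nonneg _)
    calc ‖z + ((0 : ℝ) : ℂ) * c‖ ^ (m 0) * ‖z + ((0 : ℝ) : ℂ) * c‖ ^ (m 1) ≤ 1 * 1 :=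
          mul_le_mul (pow_le_one₀ (norm_nonneg _) hw) (pow_le_one₀ (norm_nonneg _) hw)
            (pow_nonneg (norm_nonneg _) _) zero_le_one
      _ = 1 := one_mul 1

/-- **Second termwise derivative of `u` along a line** (bound `(a+b)²|u_m| ≤ C₂ ϱ^{a+b}|u_m|`).
[cite: ArioliKoch2019, §3 Lemma 3.1 (ρ > 1 regularity)] -/
theorem hasDerivAt_lineSeriesD1 (hϱ1 : 1 < ϱ) (u : Wiener (coneSubmultWeight hϱ1.le)) {z c : ℂ}
    (hz : ‖z‖ < 1) (hc : ‖c‖ ≤ 1) {t : ℝ} (ht : t ∈ Ioo (-(1 - ‖z‖)) (1 - ‖z‖)) :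
    HasDerivAt (lineSeriesD1 hϱ1.le u z c) (lineSeriesD2 hϱ1.le u z c t) t := by
  have hϱ : 1 ≤ ϱ := hϱ1.le
  have h0 : (0 : ℝ) ∈ Ioo (-(1 - ‖z‖)) (1 - ‖z‖) := by constructor <;> linarith
  set C₂ : ℝ := 2 / (ϱ - 1) ^ 2 + 1 / (ϱ - 1) with hC₂
  set C₁ : ℝ := 1 / (ϱ - 1) + 2 with hC₁
  have hdom : Summable fun m => C₂ * (|cf u m| * (coneSubmultWeight hϱ).toFun m) := (mem_cf u).mul_left C₂
  unfold lineSeriesD1 lineSeriesD2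
  refine hasDerivAt_tsum_of_isPreconnected hdom isOpen_Ioo isPreconnected_Ioo
    (fun m y _ => (hasDerivAt_mpathD1 (m 0) (m 1) z c y).const_mul _) (fun m y hy => ?_) h0 ?_ ht
  · rw [norm_mul, Complex.norm_real, Real.norm_eq_abs]
    have hb := norm_mpathD2_le (m 0) (m 1) (norm_line_le_one' hc hy) hc
    have hg := (deg_le_weight hϱ1 m).2
    calc |cf u m| * ‖mpathD2 (m 0) (m 1) z c y‖ ≤ |cf u m| * (C₂ * (coneSubmultWeight hϱ).toFun m) :=
          mul_le_mul_of_nonneg_left (hb.trans hg) (abs_nonneg _)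
      _ = C₂ * (|cf u m| * (coneSubmultWeight hϱ).toFun m) := by ring
  · have hdom1 : Summable fun m => C₁ * (|cf u m| * (coneSubmultWeight hϱ).toFun m) :=
      (mem_cf u).mul_left C₁
    refine Summable.of_norm_bounded hdom1 fun m => ?_
    rw [norm_mul, Complex.norm_real, Real.norm_eq_abs]
    have hb := norm_mpathD1_le (m 0) (m 1) (norm_line_le_one' hc h0) hc
    have hg := (deg_le_weight hϱ1 m).1
    calc |cf u m| * ‖mpathD1 (m 0) (m 1) z c 0‖ ≤ |cf u m| * (C₁ * (coneSubmultWeight hϱ).toFun m) :=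
          mul_le_mul_of_nonneg_left (hb.trans hg) (abs_nonneg _)
      _ = C₁ * (|cf u m| * (coneSubmultWeight hϱ).toFun m) := by ring

/-- `∂²_t eval u (z + tc)|₀ = Σ_m u_m ∂²_t M_m(z+tc)|₀` (`|z| < 1`, `|c| ≤ 1`, `ϱ > 1`).
[cite: ArioliKoch2019, §3 Lemma 3.1] -/
theorem iteratedDeriv_two_eval_line (hϱ1 : 1 < ϱ) (u : Wiener (coneSubmultWeight hϱ1.le)) {z c : ℂ}
    (hz : ‖z‖ < 1) (hc : ‖c‖ ≤ 1) :
    iteratedDeriv 2 (fun t : ℝ => eval hϱ1.le u (z + (t : ℂ) * c)) 0 = lineSeriesD2 hϱ1.le u z c 0 := by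
  have h0 : (0 : ℝ) ∈ Ioo (-(1 - ‖z‖)) (1 - ‖z‖) := by constructor <;> linarith
  rw [eval_line_eq, iteratedDeriv_two']
  have hder : deriv (lineSeries hϱ1.le u z c) =ᶠ[𝓝 0] lineSeriesD1 hϱ1.le u z c := by
    refine Filter.eventuallyEq_of_mem (isOpen_Ioo.mem_nhds h0) fun y hy => ?_
    exact (hasDerivAt_lineSeries hϱ1 u hz hc hy).deriv
  rw [hder.deriv_eq]
  exact (hasDerivAt_lineSeriesD1 hϱ1 u hz hc h0).deriv

/-- The two termwise second-derivative series at `t = 0` converge (for the sum over the directions).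
[cite: ArioliKoch2019, §3 Lemma 3.1] -/
theorem summable_lineD2_zero (hϱ1 : 1 < ϱ) (u : Wiener (coneSubmultWeight hϱ1.le)) {z c : ℂ}
    (hz : ‖z‖ < 1) (hc : ‖c‖ ≤ 1) :
    Summable fun m => (cf u m : ℂ) * mpathD2 (m 0) (m 1) z c 0 := by
  have hϱ : 1 ≤ ϱ := hϱ1.le
  have h0 : (0 : ℝ) ∈ Ioo (-(1 - ‖z‖)) (1 - ‖z‖) := by constructor <;> linarith
  set C₂ : ℝ := 2 / (ϱ - 1) ^ 2 + 1 / (ϱ - 1) with hC₂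
  have hdom : Summable fun m => C₂ * (|cf u m| * (coneSubmultWeight hϱ).toFun m) := (mem_cf u).mul_left C₂
  refine Summable.of_norm_bounded hdom fun m => ?_
  rw [norm_mul, Complex.norm_real, Real.norm_eq_abs]
  have hb := norm_mpathD2_le (m 0) (m 1) (norm_line_le_one' hc h0) hc
  have hg := (deg_le_weight hϱ1 m).2
  calc |cf u m| * ‖mpathD2 (m 0) (m 1) z c 0‖ ≤ |cf u m| * (C₂ * (coneSubmultWeight hϱ).toFun m) :=
        mul_le_mul_of_nonneg_left (hb.trans hg) (abs_nonneg _)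
    _ = C₂ * (|cf u m| * (coneSubmultWeight hϱ).toFun m) := by ring

/-- **Termwise Laplacian of a cone series:** for `ϱ > 1`, `u ∈ W` and `|z| < 1`,
`Δ(eval u)(z) = Σ_{(a,b)} u_{ab} · 4ab z^{a−1} z̄^{b−1}` (`Δ = ConeMonomial.lapRI`).
[cite: ArioliKoch2019, §2 eqs. (2.7)–(2.10) (Δ = 4∂_z∂_z̄ termwise); §3 Lemma 3.1 (ρ > 1)] -/
theorem lapRI_eval (hϱ1 : 1 < ϱ) (u : Wiener (coneSubmultWeight hϱ1.le)) {z : ℂ} (hz : ‖z‖ < 1) :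
    lapRI (fun w => eval hϱ1.le u w) z
      = ∑' m, (cf u m : ℂ) * (4 * ((m 0 : ℕ) : ℂ) * ((m 1 : ℕ) : ℂ) * z ^ (m 0 - 1)
          * (starRingEnd ℂ z) ^ (m 1 - 1)) := by
  unfold lapRI
  have e1 : (fun t : ℝ => eval hϱ1.le u (z + (t : ℂ)))
      = fun t : ℝ => eval hϱ1.le u (z + (t : ℂ) * 1) := by
    funext t; rw [mul_one]
  rw [e1, iteratedDeriv_two_eval_line hϱ1 u hz (by simp), iteratedDeriv_two_eval_line hϱ1 u hz (by simp)]
  unfold lineSeriesD2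
  rw [← (summable_lineD2_zero hϱ1 u hz (by simp)).tsum_add (summable_lineD2_zero hϱ1 u hz (by simp))]
  refine tsum_congr fun m => ?_
  rw [← mul_add, mpathD2_one_add_I]

/-! ### §3. Harmonic (pure-power) series and the interior equation of the certificate's zero -/

/-- A cone series supported on pure powers `ζ^a`, `ζ̄^b` (harmonic polynomials / harmonic extensions of
boundary data) has `Δ(eval u) = 0` on the open disk.
[cite: ArioliKoch2019, §2 Lemma 2.1 (Δz^k = Δz̄^k = 0); §3 Lemma 3.1] -/
theorem lapRI_eval_eq_zero_of_purePowers (hϱ1 : 1 < ϱ) (u : Wiener (coneSubmultWeight hϱ1.le))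
    (hu : ∀ m : Fin 2 →₀ ℕ, cf u m ≠ 0 → m 0 = 0 ∨ m 1 = 0) {z : ℂ} (hz : ‖z‖ < 1) :
    lapRI (fun w => eval hϱ1.le u w) z = 0 := by
  rw [lapRI_eval hϱ1 u hz]
  refine (tsum_congr fun m => ?_).trans tsum_zero
  by_cases h : cf u m = 0
  · rw [h, Complex.ofReal_zero, zero_mul]
  · rcases hu m h with h0 | h0 <;> rw [h0, Nat.cast_zero] <;> ring

/-- [folklore] Second derivative of a sum from `HasDerivAt` data on an open interval around `0`. -/
private theorem iteratedDeriv_two_add_of_hasDerivAt {f h f₁ h₁ : ℝ → ℂ} {f₂ h₂ : ℂ} {s : Set ℝ}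
    (hs : IsOpen s) (h0 : (0 : ℝ) ∈ s) (hf : ∀ t ∈ s, HasDerivAt f (f₁ t) t)
    (hh : ∀ t ∈ s, HasDerivAt h (h₁ t) t) (hf₂ : HasDerivAt f₁ f₂ 0) (hh₂ : HasDerivAt h₁ h₂ 0) :
    iteratedDeriv 2 (fun t => f t + h t) 0 = f₂ + h₂ := by
  rw [iteratedDeriv_two']
  have hder : deriv (fun t => f t + h t) =ᶠ[𝓝 0] fun t => f₁ t + h₁ t := by
    refine Filter.eventuallyEq_of_mem (hs.mem_nhds h0) fun y hy => ?_
    exact ((hf y hy).add (hh y hy)).deriv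
  rw [hder.deriv_eq]
  exact (hf₂.add hh₂).deriv

/-- `∂²_t` of `(Δ_D⁻¹y + g)(z + tc)` at `0` is the sum of the two termwise second derivatives.
[cite: ArioliKoch2019, §3 Lemma 3.1; eq. (1.4) (p. 4) and §4 Lemma 4.1 (pp. 9–10)] -/
theorem iteratedDeriv_two_eval_dirInv_add (hϱ1 : 1 < ϱ) (y g : Wiener (coneSubmultWeight hϱ1.le))
    {z c : ℂ} (hz : ‖z‖ < 1) (hc : ‖c‖ ≤ 1) :
    iteratedDeriv 2 (fun t : ℝ => eval hϱ1.le (dirInv hϱ1.le y + g) (z + (t : ℂ) * c)) 0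
      = colSeriesD2 hϱ1.le y z c 0 + lineSeriesD2 hϱ1.le g z c 0 := by
  have hϱ : 1 ≤ ϱ := hϱ1.le
  have h0 : (0 : ℝ) ∈ Ioo (-(1 - ‖z‖)) (1 - ‖z‖) := by constructor <;> linarith
  -- near 0 the function is `colSeries y + lineSeries g`
  have he : (fun t : ℝ => eval hϱ (dirInv hϱ y + g) (z + (t : ℂ) * c))
      =ᶠ[𝓝 0] fun t => colSeries hϱ y z c t + lineSeries hϱ g z c t := by
    have h1 := eval_dirInv_line_eventuallyEq hϱ y hz hc
    have h2 := eval_line_eq hϱ g z c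
    filter_upwards [h1, Filter.eventuallyEq_of_mem (isOpen_Ioo.mem_nhds h0)
      (fun t (ht : t ∈ Ioo (-(1 - ‖z‖)) (1 - ‖z‖)) =>
        eval_add hϱ (dirInv hϱ y) g (norm_line_le_one' hc ht))] with t ht1 ht2
    rw [ht2, ht1, ← h2]
  rw [iteratedDeriv_two', (he.deriv).deriv_eq, ← iteratedDeriv_two']
  exact iteratedDeriv_two_add_of_hasDerivAt isOpen_Ioo h0
    (fun t ht => hasDerivAt_colSeries hϱ y hz hc ht) (fun t ht => hasDerivAt_lineSeries hϱ1 g hz hc ht)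
    (hasDerivAt_colSeriesD1 hϱ1 y hz hc h0) (hasDerivAt_lineSeriesD1 hϱ1 g hz hc h0)

/-- The two termwise second derivatives of the `Δ_D⁻¹` part sum to `eval y z`
(`ConeEval.lapRI_eval_dirInv`, unfolded). [cite: ArioliKoch2019, §2 Lemma 2.1] -/
theorem colSeriesD2_one_add_I (hϱ1 : 1 < ϱ) (y : Wiener (coneSubmultWeight hϱ1.le)) {z : ℂ}
    (hz : ‖z‖ < 1) : colSeriesD2 hϱ1.le y z 1 0 + colSeriesD2 hϱ1.le y z I 0 = eval hϱ1.le y z := by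
  have h := lapRI_eval_dirInv hϱ1 y hz
  unfold lapRI at h
  have e1 : (fun t : ℝ => eval hϱ1.le (dirInv hϱ1.le y) (z + (t : ℂ)))
      = fun t : ℝ => eval hϱ1.le (dirInv hϱ1.le y) (z + (t : ℂ) * 1) := by
    funext t; rw [mul_one]
  rw [e1, iteratedDeriv_two_eval_dirInv_line hϱ1 y hz (by simp),
    iteratedDeriv_two_eval_dirInv_line hϱ1 y hz (by simp)] at h
  exact h

/-- **The interior equation of the certificate's zero.**  Let `ϱ > 1` and let `x ∈ W` satisfy
`x − Δ_D⁻¹(v x + Σ_{k≤m} c_k x^k) − g = 0` (`PolynomialNonlinearity.semilinMap (dirInv …) v c m g x = 0`,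
the zero of `ConeSemilinear.cone_existsUnique_zero_of_semilin`) with a HARMONIC datum `g` (pure powers).
Then on the open unit disk `Δ(eval x)(z) = v(z)·x(z) + Σ_{k≤m} c_k(z)·x(z)^k` (and `x = g` on the unit
circle, `ConeEval.eval_eq_of_semilinMap_eq_zero`).
[cite: ArioliKoch2019, eq. (1.4) (p. 4) and §4 Lemma 4.1 (pp. 9–10) (fixed points of G solve −Δu = w f′(u) with the boundary condition)] -/
theorem lapRI_eval_of_semilinMap_eq_zero (hϱ1 : 1 < ϱ) {v g x : Wiener (coneSubmultWeight hϱ1.le)}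
    {c : ℕ → Wiener (coneSubmultWeight hϱ1.le)} {m : ℕ}
    (hx : Literature.Analysis.Calculus.PolynomialNonlinearity.semilinMap (dirInv hϱ1.le) v c m g x = 0)
    (hg : ∀ n : Fin 2 →₀ ℕ, cf g n ≠ 0 → n 0 = 0 ∨ n 1 = 0) {z : ℂ} (hz : ‖z‖ < 1) :
    lapRI (fun w => eval hϱ1.le x w) z
      = eval hϱ1.le v z * eval hϱ1.le x z
        + ∑ k ∈ Finset.range (m + 1), eval hϱ1.le (c k) z * (eval hϱ1.le x z) ^ k := by
  have hϱ : 1 ≤ ϱ := hϱ1.le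
  have h : x = dirInv hϱ (v * x + Literature.Analysis.Calculus.PolynomialNonlinearity.polyMap c m x) + g := by
    unfold Literature.Analysis.Calculus.PolynomialNonlinearity.semilinMap at hx
    have h1 := sub_eq_zero.1 hx
    rw [← h1]
    abel
  -- Δ(eval g) = 0 (harmonic datum), in the two-direction form
  have hlap_g : lapRI (fun w => eval hϱ g w) z = 0 := lapRI_eval_eq_zero_of_purePowers hϱ1 g hg hz
  unfold lapRI at hlap_g ⊢
  have eg : (fun t : ℝ => eval hϱ g (z + (t : ℂ))) = fun t : ℝ => eval hϱ g (z + (t : ℂ) * 1) := by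
    funext t; rw [mul_one]
  rw [eg, iteratedDeriv_two_eval_line hϱ1 g hz (by simp), iteratedDeriv_two_eval_line hϱ1 g hz (by simp)]
    at hlap_g
  -- rewrite the two line functions of `x` through `x = Δ_D⁻¹ y + g`
  have ex1 : (fun t : ℝ => eval hϱ x (z + (t : ℂ)))
      = fun t : ℝ => eval hϱ (dirInv hϱ (v * x
          + Literature.Analysis.Calculus.PolynomialNonlinearity.polyMap c m x) + g) (z + (t : ℂ) * 1) := by
    funext t; rw [mul_one, ← h]
  have exI : (fun t : ℝ => eval hϱ x (z + (t : ℂ) * I))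
      = fun t : ℝ => eval hϱ (dirInv hϱ (v * x
          + Literature.Analysis.Calculus.PolynomialNonlinearity.polyMap c m x) + g) (z + (t : ℂ) * I) := by
    funext t; rw [← h]
  rw [ex1, exI, iteratedDeriv_two_eval_dirInv_add hϱ1 _ g hz (by simp),
    iteratedDeriv_two_eval_dirInv_add hϱ1 _ g hz (by simp)]
  calc colSeriesD2 hϱ (v * x + Literature.Analysis.Calculus.PolynomialNonlinearity.polyMap c m x) z 1 0
        + lineSeriesD2 hϱ g z 1 0
        + (colSeriesD2 hϱ (v * x + Literature.Analysis.Calculus.PolynomialNonlinearity.polyMap c m x) z I 0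
          + lineSeriesD2 hϱ g z I 0)
      = (colSeriesD2 hϱ (v * x + Literature.Analysis.Calculus.PolynomialNonlinearity.polyMap c m x) z 1 0
          + colSeriesD2 hϱ (v * x + Literature.Analysis.Calculus.PolynomialNonlinearity.polyMap c m x) z I 0)
        + (lineSeriesD2 hϱ g z 1 0 + lineSeriesD2 hϱ g z I 0) := by ring
    _ = eval hϱ (v * x + Literature.Analysis.Calculus.PolynomialNonlinearity.polyMap c m x) z + 0 := by
        rw [colSeriesD2_one_add_I hϱ1 _ hz, hlap_g]
    _ = eval hϱ1.le v z * eval hϱ1.le x z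
        + ∑ k ∈ Finset.range (m + 1), eval hϱ1.le (c k) z * (eval hϱ1.le x z) ^ k := by
        rw [add_zero, eval_add hϱ _ _ hz.le, eval_mul hϱ _ _ hz.le]
        unfold Literature.Analysis.Calculus.PolynomialNonlinearity.polyMap
        rw [eval_polyMap hϱ c m x hz.le]

end ConeEval

end Literature.Analysis.ValidatedNumerics
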